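import Mathlib
import Literature.Probability.Percolation.DiagonalStripHyperplaneRecursion
import Literature.Probability.Percolation.DiagonalStripQKZPinning
import HarnessLib

/-!
# Wheel vanishing of the ground state (`z_2 = q z_1`, `z_3 = q z_2`)

Topic `Literature/Probability/Percolation`. For the loop-weight-one Temperley–Lieb ground state of
Ikhlef–Ponsaing (J. Stat. Phys. 149 (2012), arXiv:1202.5476, §3.4) every polynomial `t`-fixed vector
vanishes identically after the double hyperplane substitution `z_2 = q z_1`, `z_3 = q z_2 (= q² z_1)`
(`groundState_wheel_vanishing`). Proof: by eq. (25) up to a scalar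
(`groundState_hyp_recursion_odd/even` of `DiagonalStripHyperplaneRecursion`) the restriction to
`H_1` is proportional to a `φ_1`-push-forward, supported on patterns whose sites `0, 1` are joined,
and the restriction to `H_2` to a push-forward along `cpInsIso 1`, supported on patterns in which the
site `1` is a singleton; both proportionality constants survive the second substitution (the
push-forwards do not involve `z_1, z_2, z_3` except through an injective renaming), and the two
supports are disjoint. This is the input that pins the `z_1`-dependence of the recursion scalar of
(25) for the sum `Z` without the explicit nested component of §3.5.

## References

* Y. Ikhlef, A. K. Ponsaing, *Finite-size left-passage probability in percolation*, J. Stat. Phys.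
  149 (2012) 10–36, arXiv:1202.5476, §3.4–3.5. [IkhlefPonsaing2012]
-/

namespace Literature.Probability.Percolation

open Finset Literature.Probability.LatticeModels Literature.Probability.LatticeModels.TemperleyLieb

/-! ### The wheel substitution `z_2 = q z_1`, `z_3 = q z_2` -/

section Wheel

open MvPolynomial

variable {n : ℕ}

/-- `hypSubst` off the substituted variable. [folklore] -/
theorem hypSubst_X_of_ne (q : ℂ) {i k : ℕ} (hk : k ≠ i + 1) : hypSubst q i (X k) = X k := by
  rw [hypSubst_X, if_neg hk]

/-- `hypSubst` on the substituted variable. [folklore] -/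
theorem hypSubst_X_self (q : ℂ) (i : ℕ) : hypSubst q i (X (i + 1)) = C q * X i := by
  rw [hypSubst_X, if_pos rfl]

/-- `η_1 ∘ η_2 ∘ η_1 = η_1 ∘ η_2`. [folklore] -/
theorem hypSubst_one_two_comp_one (q : ℂ) :
    ((hypSubst q 1).comp (hypSubst q 2)).comp (hypSubst q 1) = (hypSubst q 1).comp (hypSubst q 2) := by
  refine ringHom_ext (fun a => by simp only [RingHom.comp_apply, hypSubst_C]) (fun k => ?_)
  simp only [RingHom.comp_apply]
  by_cases hk : k = 2
  · subst hk
    rw [show (2 : ℕ) = 1 + 1 from rfl, hypSubst_X_self, map_mul, map_mul, hypSubst_C, hypSubst_C,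
      hypSubst_X_of_ne q (show (1 : ℕ) ≠ 2 + 1 by omega), hypSubst_X_of_ne q (show (1 : ℕ) ≠ 1 + 1 by omega),
      hypSubst_X_of_ne q (show (1 + 1 : ℕ) ≠ 2 + 1 by omega), hypSubst_X_self]
  · rw [hypSubst_X_of_ne q (show k ≠ 1 + 1 by omega)]

/-- `η_1 ∘ η_2 ∘ η_2 = η_1 ∘ η_2`. [folklore] -/
theorem hypSubst_one_two_comp_two (q : ℂ) :
    ((hypSubst q 1).comp (hypSubst q 2)).comp (hypSubst q 2) = (hypSubst q 1).comp (hypSubst q 2) := by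
  refine ringHom_ext (fun a => by simp only [RingHom.comp_apply, hypSubst_C]) (fun k => ?_)
  simp only [RingHom.comp_apply]
  by_cases hk : k = 3
  · subst hk
    rw [show (3 : ℕ) = 2 + 1 from rfl, hypSubst_X_self, map_mul, hypSubst_C,
      hypSubst_X_of_ne q (show (2 : ℕ) ≠ 2 + 1 by omega)]
  · rw [hypSubst_X_of_ne q (show k ≠ 2 + 1 by omega), hypSubst_X_of_ne q (show k ≠ 2 + 1 by omega)]

/-- `η_1 ∘ η_2 ∘ ẑ_2 = ẑ_2` (the variables `X_2, X_3` do not occur after `hatRename 2`). [folklore] -/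
theorem hypSubst_one_two_comp_hatRename_two (q : ℂ) :
    ((hypSubst q 1).comp (hypSubst q 2)).comp (hatRename 2) = hatRename 2 := by
  refine ringHom_ext (fun a => by simp only [RingHom.comp_apply, hypSubst_C, hatRename_C]) (fun k => ?_)
  simp only [RingHom.comp_apply, hatRename_X]
  by_cases hk : k < 2
  · rw [if_pos hk, hypSubst_X_of_ne q (show k ≠ 2 + 1 by omega), hypSubst_X_of_ne q (show k ≠ 1 + 1 by omega)]
  · rw [if_neg hk, hypSubst_X_of_ne q (show k + 2 ≠ 2 + 1 by omega),
      hypSubst_X_of_ne q (show k + 2 ≠ 1 + 1 by omega)]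

/-- `η_1 ∘ η_2 ∘ ẑ_1` is injective (it is `X_0 ↦ X_0`, `X_1 ↦ q² X_1`, `X_k ↦ X_{k+2}`). [folklore] -/
theorem hypSubst_one_two_comp_hatRename_one_injective {q : ℂ} (hq0 : q ≠ 0) :
    Function.Injective (((hypSubst q 1).comp (hypSubst q 2)).comp (hatRename (K₀ := ℂ) 1)) := by
  -- an explicit left inverse
  let L : MvPolynomial ℕ ℂ →+* MvPolynomial ℕ ℂ :=
    (aeval (R := ℂ) fun j : ℕ => if j = 0 then X 0 else if j = 1 then C (q * q)⁻¹ * X 1 else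
      if j < 4 then 0 else X (j - 2)).toRingHom
  have hLC : ∀ a, L (C a) = C a := fun a => by simp [L]
  have hLX : ∀ j, L (X j) = (if j = 0 then X 0 else if j = 1 then C (q * q)⁻¹ * X 1 else
      if j < 4 then 0 else X (j - 2)) := fun j => by simp [L]
  have hleft : L.comp (((hypSubst q 1).comp (hypSubst q 2)).comp (hatRename 1)) = RingHom.id _ := by
    refine ringHom_ext (fun a => by simp only [RingHom.comp_apply, hypSubst_C, hatRename_C, hLC, RingHom.id_apply])
      (fun k => ?_)
    simp only [RingHom.comp_apply, hatRename_X, RingHom.id_apply]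
    by_cases hk0 : k = 0
    · subst hk0
      rw [if_pos (by omega), hypSubst_X_of_ne q (show (0 : ℕ) ≠ 2 + 1 by omega),
        hypSubst_X_of_ne q (show (0 : ℕ) ≠ 1 + 1 by omega), hLX, if_pos rfl]
    by_cases hk1 : k = 1
    · subst hk1
      rw [if_neg (by omega), show (1 : ℕ) + 2 = 2 + 1 from rfl, hypSubst_X_self, map_mul, hypSubst_C,
        show (2 : ℕ) = 1 + 1 from rfl, hypSubst_X_self, map_mul, map_mul, hLC, hLX, if_neg (by omega),
        if_pos rfl, ← mul_assoc, ← mul_assoc, ← map_mul, ← map_mul,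
        show q * q * (q * q)⁻¹ = 1 from mul_inv_cancel₀ (mul_ne_zero hq0 hq0), C_1, one_mul]
    · rw [if_neg (by omega), hypSubst_X_of_ne q (show k + 2 ≠ 2 + 1 by omega),
        hypSubst_X_of_ne q (show k + 2 ≠ 1 + 1 by omega), hLX, if_neg (by omega), if_neg (by omega),
        if_neg (by omega), Nat.add_sub_cancel]
  refine Function.LeftInverse.injective (g := L) fun f => ?_
  have := RingHom.congr_fun hleft f
  simpa using this

/-- **Wheel vanishing of the ground state**: every polynomial `t`-fixed vector vanishes identically
under `z_2 = q z_1`, `z_3 = q z_2` (`= q² z_1`). On `H_1` the vector is proportional to a `φ_1`-push-forward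
(supported on patterns with the sites `0, 1` joined), on `H_2` to a push-forward along `cpInsIso 1`
(site `1` a singleton); the two supports are disjoint. [cite: IkhlefPonsaing2012, §3.4–3.5] -/
theorem groundState_wheel_vanishing {q : ℂ} (hq : q ^ 2 + q + 1 = 0) {P : ColPattern (n + 1) → MvPolynomial ℕ ℂ}
    (hP : ∀ Q', ∑ Q, ipTransferMatrixW (n + 1) (genC ℂ q) (genW ℂ) (genZ ℂ) Q Q' * toRF ℂ (P Q) = toRF ℂ (P Q'))
    (Q : ColPattern (n + 1)) : hypSubst q 1 (hypSubst q 2 (P Q)) = 0 := by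
  classical
  have hq0 : q ≠ 0 := q_ne_zero_of_quad hq
  obtain ⟨P'', hprim'', hP''⟩ := exists_ipTransferMatrixW_fixed_primitive (m := n) hq
  have hP''0 : P'' ≠ 0 := by
    obtain ⟨R₀, hR₀⟩ := hprim''.exists_ne_zero
    intro h; exact hR₀ (congrFun h R₀)
  set S : MvPolynomial ℕ ℂ →+* MvPolynomial ℕ ℂ := (hypSubst q 1).comp (hypSubst q 2) with hSdef
  have hS1 : ∀ f, S (hypSubst q 1 f) = S f := fun f => by
    show (S.comp (hypSubst q 1)) f = S f
    rw [hSdef, hypSubst_one_two_comp_one]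
  have hS2 : ∀ f, S (hypSubst q 2 f) = S f := fun f => by
    show (S.comp (hypSubst q 2)) f = S f
    rw [hSdef, hypSubst_one_two_comp_two]
  -- the two polynomial push-forwards
  set Φ₁ : ColPattern (n + 1) → MvPolynomial ℕ ℂ := fun Q =>
    ∑ R ∈ Finset.univ.filter (fun R => cpInsDup 0 R = Q), hatRename 1 (P'' R) with hΦ₁
  set Φ₂ : ColPattern (n + 1) → MvPolynomial ℕ ℂ := fun Q =>
    ∑ R ∈ Finset.univ.filter (fun R => cpInsIso 1 R = Q), hatRename 2 (P'' R) with hΦ₂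
  -- (25) up to scalar on `H_1` and on `H_2`, as polynomial identities
  obtain ⟨k₀, hk₀⟩ : ∃ k₀, Φ₁ k₀ ≠ 0 := by
    have h := pushforward_cpInsDup_ne_zero hq (0 : Fin (n + 1)) hP''0
    simp only [Fin.val_zero, mul_zero, zero_add] at h
    by_contra hall; push Not at hall
    exact h (funext fun Q => by rw [Pi.zero_apply, ← map_sum, show (∑ R ∈ Finset.univ.filter
      (fun R => cpInsDup 0 R = Q), hatRename 1 (P'' R)) = Φ₁ Q from rfl, hall Q, map_zero])
  obtain ⟨k₁, hk₁⟩ : ∃ k₁, Φ₂ k₁ ≠ 0 := by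
    have h := pushforward_cpInsIso_ne_zero hq (1 : Fin (n + 2)) (by simp) hP''0 hP''
    simp only [Fin.val_one, mul_one] at h
    by_contra hall; push Not at hall
    exact h (funext fun Q => by rw [Pi.zero_apply, ← map_sum, show (∑ R ∈ Finset.univ.filter
      (fun R => cpInsIso 1 R = Q), hatRename 2 (P'' R)) = Φ₂ Q from rfl, hall Q, map_zero])
  have I1 : ∀ Q, Φ₁ k₀ * hypSubst q 1 (P Q) = hypSubst q 1 (P k₀) * Φ₁ Q := by
    intro Q
    have h := congrFun (groundState_hyp_recursion_odd hq (0 : Fin (n + 1)) hP hP'' k₀) Q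
    simp only [Fin.val_zero, mul_zero, zero_add, Pi.smul_apply, smul_eq_mul] at h
    apply toRF_injective
    rw [map_mul, map_mul, hΦ₁]; simp only [map_sum]
    exact h
  have I2 : ∀ Q, Φ₂ k₁ * hypSubst q 2 (P Q) = hypSubst q 2 (P k₁) * Φ₂ Q := by
    intro Q
    have h := congrFun (groundState_hyp_recursion_even hq (1 : Fin (n + 2)) (by simp) hP hP'' k₁) Q
    simp only [Fin.val_one, mul_one, Pi.smul_apply, smul_eq_mul] at h
    apply toRF_injective
    rw [map_mul, map_mul, hΦ₂]; simp only [map_sum]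
    exact h
  -- through `S`
  have J1 : ∀ Q, S (Φ₁ k₀) * S (P Q) = S (P k₀) * S (Φ₁ Q) := by
    intro Q; have := congrArg S (I1 Q); rwa [map_mul, map_mul, hS1, hS1] at this
  have J2 : ∀ Q, S (Φ₂ k₁) * S (P Q) = S (P k₁) * S (Φ₂ Q) := by
    intro Q; have := congrArg S (I2 Q); rwa [map_mul, map_mul, hS2, hS2] at this
  -- the push-forwards stay nonzero under `S`
  have hSΦ₁ : S (Φ₁ k₀) ≠ 0 := by
    have e : S (Φ₁ k₀) = (S.comp (hatRename 1)) (∑ R ∈ Finset.univ.filter (fun R => cpInsDup 0 R = k₀), P'' R) := by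
      simp only [hΦ₁, RingHom.comp_apply, map_sum]
    rw [e, Ne, ← (S.comp (hatRename 1)).map_zero,
      (hypSubst_one_two_comp_hatRename_one_injective hq0).eq_iff]
    intro h0
    apply hk₀
    show (∑ R ∈ Finset.univ.filter (fun R => cpInsDup 0 R = k₀), hatRename 1 (P'' R)) = 0
    rw [← map_sum, h0, map_zero]
  have hSΦ₂ : S (Φ₂ k₁) ≠ 0 := by
    have e2 : ∀ f, S (hatRename 2 f) = hatRename 2 f := fun f => by
      show (S.comp (hatRename 2)) f = _
      rw [hSdef, hypSubst_one_two_comp_hatRename_two]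
    have e : S (Φ₂ k₁) = Φ₂ k₁ := by
      show S (∑ R ∈ Finset.univ.filter (fun R => cpInsIso 1 R = k₁), hatRename 2 (P'' R)) =
        ∑ R ∈ Finset.univ.filter (fun R => cpInsIso 1 R = k₁), hatRename 2 (P'' R)
      rw [map_sum]
      exact Finset.sum_congr rfl fun R _ => e2 _
    rw [e]; exact hk₁
  -- supports of the push-forwards
  have sup1 : ∀ Q, S (Φ₁ Q) ≠ 0 → Q.1 0 1 = true := by
    intro Q h
    obtain ⟨R, hR, hR0⟩ : ∃ R ∈ Finset.univ.filter (fun R => cpInsDup 0 R = Q), P'' R ≠ 0 := by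
      by_contra hall; push Not at hall
      apply h
      rw [hΦ₁]; simp only
      rw [Finset.sum_congr rfl fun R hR => by rw [hall R hR, map_zero], Finset.sum_const_zero, map_zero]
    have hRv : IsValid 0 R :=
      (groundState_support hq hP'' (Q := R) fun h0 => hR0 (toRF_injective (h0.trans (map_zero _).symm))).1
    rw [← (Finset.mem_filter.1 hR).2, cpInsDup_fst]
    exact hRv.refl _
  have sup2 : ∀ Q, S (Φ₂ Q) ≠ 0 → Q.1 0 1 = false := by
    intro Q h
    obtain ⟨R, hR, -⟩ : ∃ R ∈ Finset.univ.filter (fun R => cpInsIso 1 R = Q), P'' R ≠ 0 := by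
      by_contra hall; push Not at hall
      apply h
      rw [hΦ₂]; simp only
      rw [Finset.sum_congr rfl fun R hR => by rw [hall R hR, map_zero], Finset.sum_const_zero, map_zero]
    rw [← (Finset.mem_filter.1 hR).2]
    show SiteRel.insertIso R.1 1 0 1 = false
    rw [SiteRel.insertIso_self_right, decide_eq_false_iff_not]
    exact (Fin.zero_lt_one).ne
  -- conclusion
  show S (P Q) = 0
  by_contra hne
  by_cases h₀ : S (P k₀) = 0
  · exact hne ((mul_eq_zero.1 ((J1 Q).trans (by rw [h₀, zero_mul]))).resolve_left hSΦ₁)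
  by_cases h₁ : S (P k₁) = 0
  · exact hne ((mul_eq_zero.1 ((J2 Q).trans (by rw [h₁, zero_mul]))).resolve_left hSΦ₂)
  have a1 : S (Φ₁ Q) ≠ 0 := fun h => by
    have := J1 Q; rw [h, mul_zero] at this
    exact (mul_ne_zero hSΦ₁ hne) this
  have a2 : S (Φ₂ Q) ≠ 0 := fun h => by
    have := J2 Q; rw [h, mul_zero] at this
    exact (mul_ne_zero hSΦ₂ hne) this
  have := sup1 Q a1
  rw [sup2 Q a2] at this
  exact Bool.false_ne_true this

end Wheel

end Literature.Probability.Percolation
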